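import Mathlib
import Summits.NavierStokesRegularity.FluidComputer.AbcClassIISynthesis

/-!
# INERTIA-3L instantiation, Part 2: the BALL index sets of a certificate and their structure (R3)/(R4)
# (instab3 g8, cell `ns-blowup`, 2026-08-27)

HONEST FRAMING (human ruling D-0035): nothing here is a claim about Navier–Stokes blow-up.
WHAT THIS IS NOT: not NS evidence. MODEL lane (forced-ABC linearisation, class II, coordinates of
`AbcClassIIDefs`); no certificate, number or census word moves.

An INERTIA-3L certificate (`HOME/instab3/PREREG-INERTIA-3L.md`, INSTAB3-METHOD §14.2; INERTIA-I4 §3) cuts the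
class-II index type `Idx` by the EUCLIDEAN norm of the orbits: head `L = {|O|² ≤ r_L²}`, junction head
`H = {|O|² ≤ r_H²} ⊇ L`, first tail shell `B = {r_H² < |O|² ≤ (r_H+1)²}`, `r_H ≥ r_L + 1`. This file takes
the three index sets as `Finset`s characterised by membership and proves the structural facts the format
calls (R4) and the per-index form of the tail constant (R3):

* §1 adjacency is Euclidean-local: `j ∈ nbrIdx i ⇒ |√|O_j|² − √|O_i|²| ≤ 1` (`|k ± e_m| ≤ |k| + 1`);
* §2 (R4): neighbours of `L` lie in `H`; neighbours of `H` outside `H` lie in `B`; an index outside `H` with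
  a neighbour in `H` lies in `B` and that neighbour is not in `L`; `amat` vanishes across `L × B`;
  `H ∩ B = ∅`, `L ⊆ H`;
* §3 (R3) per index: `|O|²` is a natural number, so `√2 < (⌊r_H²⌋ + 1)/R + a` gives
  `0 < |O_i|²/R + a − √2` for every `i ∉ H`;
* §4 the three index sets EXIST as `Finset`s (`exists_ballIdx`, `exists_shellIdx`; `‖k‖_∞ ≤ |k|`).

Mathlib + `AbcClassIISynthesis`; no new definitions; std axioms. [folklore]
-/

noncomputable section

open scoped BigOperators
open Finset

namespace Summit.NavierStokesRegularity.FluidComputer.AbcInertia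

open Literature.Analysis.FunctionSpaces Literature.Analysis.FunctionSpaces.Torus
open Literature.Analysis.FluidPDE
open Summit.NavierStokesRegularity.FluidComputer.AbcClassII

/-! ### §1 Adjacency is Euclidean-local -/

/-- `√(freqNormSq k)` is the Euclidean norm of the real vector `k`. -/
theorem sqrt_freqNormSq_eq_norm (k : Fin 3 → ℤ) :
    Real.sqrt (freqNormSq k) = ‖(WithLp.toLp 2 (fun i => (k i : ℝ)) : EuclideanSpace ℝ (Fin 3))‖ := by
  rw [EuclideanSpace.norm_eq, freqNormSq]
  congr 1
  refine Finset.sum_congr rfl fun i _ => ?_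
  simp [sq_abs]

/-- `|k − s| ≤ |k| + 1` and `|k| ≤ |k − s| + 1` for `s ∈ {±e_m}`. -/
theorem sqrt_freqNormSq_sub_abcFreq (k : Fin 3 → ℤ) {s : Fin 3 → ℤ} (hs : s ∈ Torus.abcFreq) :
    Real.sqrt (freqNormSq (k - s)) ≤ Real.sqrt (freqNormSq k) + 1 ∧
      Real.sqrt (freqNormSq k) ≤ Real.sqrt (freqNormSq (k - s)) + 1 := by
  have h1 : Real.sqrt (freqNormSq s) = 1 := by
    obtain ⟨y, rfl⟩ := Torus.mem_abcFreq.mp hs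
    rw [Torus.freqNormSq_abcDir, Real.sqrt_one]
  set vk : EuclideanSpace ℝ (Fin 3) := WithLp.toLp 2 (fun i => (k i : ℝ)) with hvk
  set vs : EuclideanSpace ℝ (Fin 3) := WithLp.toLp 2 (fun i => (s i : ℝ)) with hvs
  have hsub : (WithLp.toLp 2 (fun i => ((k - s) i : ℝ)) : EuclideanSpace ℝ (Fin 3)) = vk - vs := by
    ext i; simp [hvk, hvs]
  rw [sqrt_freqNormSq_eq_norm, sqrt_freqNormSq_eq_norm, hsub]
  rw [sqrt_freqNormSq_eq_norm] at h1
  change ‖vs‖ = 1 at h1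
  constructor
  · calc ‖vk - vs‖ ≤ ‖vk‖ + ‖vs‖ := norm_sub_le _ _
      _ = ‖vk‖ + 1 := by rw [h1]
  · calc ‖vk‖ = ‖(vk - vs) + vs‖ := by rw [sub_add_cancel]
      _ ≤ ‖vk - vs‖ + ‖vs‖ := norm_add_le _ _
      _ = ‖vk - vs‖ + 1 := by rw [h1]

/-- **Adjacent orbits differ by at most one in Euclidean norm**:
`j ∈ nbrIdx i ⇒ √|O_j|² ≤ √|O_i|² + 1 ∧ √|O_i|² ≤ √|O_j|² + 1`. -/
theorem sqrt_onormSq_le_of_mem_nbrIdx {i j : Idx} (h : j ∈ nbrIdx i) :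
    Real.sqrt (onormSq j.1) ≤ Real.sqrt (onormSq i.1) + 1 ∧
      Real.sqrt (onormSq i.1) ≤ Real.sqrt (onormSq j.1) + 1 := by
  obtain ⟨k, hk, s, hs, hks⟩ := mem_nbrOrbits.mp (mem_nbrIdx.mp h)
  rw [← i.1.freqNormSq_eq hk, ← j.1.freqNormSq_eq hks]
  exact sqrt_freqNormSq_sub_abcFreq k hs

/-- `√|O|²` recovers `|O|²`. -/
theorem sq_sqrt_onormSq (O : Orbit) : Real.sqrt (onormSq O) ^ 2 = onormSq O :=
  Real.sq_sqrt (onormSq_nonneg O)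

/-! ### §2 (R4): the structure of the three index sets -/

section IndexSets

variable {rL rH : ℝ} (h0 : 0 ≤ rL) (hLH : rL + 1 ≤ rH)
variable {HL HH HB : Finset Idx}
variable (hHL : ∀ i : Idx, i ∈ HL ↔ onormSq i.1 ≤ rL ^ 2)
variable (hHH : ∀ i : Idx, i ∈ HH ↔ onormSq i.1 ≤ rH ^ 2)
variable (hHB : ∀ i : Idx, i ∈ HB ↔ rH ^ 2 < onormSq i.1 ∧ onormSq i.1 ≤ (rH + 1) ^ 2)

/-- `|O|² ≤ r²` iff `√|O|² ≤ r` for `r ≥ 0`. -/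
theorem onormSq_le_sq_iff {r : ℝ} (hr : 0 ≤ r) (O : Orbit) : onormSq O ≤ r ^ 2 ↔ Real.sqrt (onormSq O) ≤ r := by
  constructor
  · intro h; exact (Real.sqrt_le_sqrt h).trans_eq (Real.sqrt_sq hr)
  · intro h
    have := pow_le_pow_left₀ (Real.sqrt_nonneg _) h 2
    rwa [sq_sqrt_onormSq] at this

include h0 hLH hHL hHH in
/-- `L ⊆ H`. -/
theorem HL_subset_HH : HL ⊆ HH := by
  intro i hi
  rw [hHH]
  have h1 := (hHL i).mp hi
  have : rL ^ 2 ≤ rH ^ 2 := pow_le_pow_left₀ h0 (by linarith) 2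
  linarith

include h0 hLH hHL hHH in
/-- **(R4a) Neighbours of the head `L` lie in `H`** (`r_H ≥ r_L + 1`): the `L`-rows of `L − a` see only `H`. -/
theorem mem_HH_of_mem_nbrIdx_of_mem_HL {i j : Idx} (hi : i ∈ HL) (hj : j ∈ nbrIdx i) : j ∈ HH := by
  rw [hHH]
  have hrH : 0 ≤ rH := by linarith
  rw [onormSq_le_sq_iff hrH]
  have h1 := (sqrt_onormSq_le_of_mem_nbrIdx hj).1
  have h2 : Real.sqrt (onormSq i.1) ≤ rL := (onormSq_le_sq_iff h0 i.1).mp ((hHL i).mp hi)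
  linarith

include h0 hLH hHH hHB in
/-- **(R4b) Neighbours of `H` outside `H` lie in the first tail shell `B`.** -/
theorem mem_HB_of_mem_nbrIdx_of_mem_HH {i j : Idx} (hi : i ∈ HH) (hj : j ∈ nbrIdx i) (hjH : j ∉ HH) :
    j ∈ HB := by
  have hrH : 0 ≤ rH := by linarith
  rw [hHB]
  rw [hHH] at hjH hi
  refine ⟨lt_of_not_ge hjH, ?_⟩
  rw [onormSq_le_sq_iff (by linarith)]
  have h1 := (sqrt_onormSq_le_of_mem_nbrIdx hj).1
  have h2 : Real.sqrt (onormSq i.1) ≤ rH := (onormSq_le_sq_iff hrH i.1).mp hi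
  linarith

include h0 hLH hHL hHH hHB in
/-- **(R4c) An index outside `H` with a neighbour inside `H` lies in `B`, and that neighbour is outside `L`.** -/
theorem mem_HB_of_not_mem_HH {i j : Idx} (hi : i ∉ HH) (hj : j ∈ nbrIdx i) (hjH : j ∈ HH) :
    i ∈ HB ∧ j ∉ HL := by
  have hrH : 0 ≤ rH := by linarith
  constructor
  · exact mem_HB_of_mem_nbrIdx_of_mem_HH h0 hLH hHH hHB hjH ((mem_nbrIdx_comm j i).mpr hj) hi
  · intro hjL
    exact hi (mem_HH_of_mem_nbrIdx_of_mem_HL h0 hLH hHL hHH hjL ((mem_nbrIdx_comm j i).mpr hj))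

include h0 hLH hHL hHH hHB in
/-- `L` and `B` are not adjacent. -/
theorem not_mem_nbrIdx_of_HL_HB {i j : Idx} (hi : i ∈ HL) (hj : j ∈ HB) : j ∉ nbrIdx i := by
  intro hmem
  have hjH := mem_HH_of_mem_nbrIdx_of_mem_HL h0 hLH hHL hHH hi hmem
  rw [hHH] at hjH
  have := ((hHB j).mp hj).1
  linarith

include h0 hLH hHL hHH hHB in
/-- **(R4d) `amat` vanishes across `L × B`** (both orders). -/
theorem amat_eq_zero_of_HL_HB {i j : Idx} (hi : i ∈ HL) (hj : j ∈ HB) : amat i j = 0 ∧ amat j i = 0 :=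
  ⟨amat_eq_zero_of_not_mem (not_mem_nbrIdx_of_HL_HB h0 hLH hHL hHH hHB hi hj),
    amat_eq_zero_of_not_mem fun h => not_mem_nbrIdx_of_HL_HB h0 hLH hHL hHH hHB hi hj
      ((mem_nbrIdx_comm j i).mp h)⟩

include hHH hHB in
/-- `B` lies outside `H`. -/
theorem not_mem_HH_of_mem_HB {i : Idx} (hi : i ∈ HB) : i ∉ HH := by
  rw [hHH]; exact not_le.mpr ((hHB i).mp hi).1

include hHH hHB in
/-- `H ∩ B = ∅`. -/
theorem disjoint_HH_HB : Disjoint HH HB :=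
  Finset.disjoint_right.mpr fun _ hi => not_mem_HH_of_mem_HB hHH hHB hi

end IndexSets

/-! ### §3 (R3) per index -/

/-- `|O|²` is a natural number. -/
theorem exists_onormSq_eq_natCast (O : Orbit) : ∃ n : ℕ, onormSq O = n := by
  refine ⟨(∑ i, (O.rep i) ^ 2).toNat, ?_⟩
  have hnn : 0 ≤ ∑ i, (O.rep i) ^ 2 := Finset.sum_nonneg fun i _ => sq_nonneg _
  rw [onormSq, freqNormSq]
  have : ((∑ i, (O.rep i) ^ 2).toNat : ℝ) = ((∑ i, (O.rep i) ^ 2 : ℤ) : ℝ) := by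
    rw [← Int.toNat_of_nonneg hnn]
    push_cast
    rw [Int.toNat_of_nonneg hnn]
  rw [this]; push_cast; rfl

/-- **(R3) per index**: if `√2 < (⌊r_H²⌋ + 1)/R + a` and `|O_i|² > r_H²` then `0 < |O_i|²/R + a − √2`. -/
theorem tailConst_pos {R a rH : ℝ} (hR : 0 < R) (hR3 : Real.sqrt 2 < ((⌊rH ^ 2⌋₊ : ℝ) + 1) / R + a)
    {O : Orbit} (hO : rH ^ 2 < onormSq O) : 0 < onormSq O / R + a - Real.sqrt 2 := by
  obtain ⟨n, hn⟩ := exists_onormSq_eq_natCast O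
  have hfl : ((⌊rH ^ 2⌋₊ : ℝ) + 1) ≤ onormSq O := by
    rw [hn] at hO ⊢
    have h1 : ⌊rH ^ 2⌋₊ < n := (Nat.floor_lt (sq_nonneg _)).mpr hO
    exact_mod_cast h1
  have hdiv : ((⌊rH ^ 2⌋₊ : ℝ) + 1) / R ≤ onormSq O / R := div_le_div_of_nonneg_right hfl hR.le
  linarith

/-- (R3) outside `H`, for a membership-characterised `H`. -/
theorem tailConst_pos_of_not_mem {R a rH : ℝ} (hR : 0 < R)
    (hR3 : Real.sqrt 2 < ((⌊rH ^ 2⌋₊ : ℝ) + 1) / R + a) {HH : Finset Idx}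
    (hHH : ∀ i : Idx, i ∈ HH ↔ onormSq i.1 ≤ rH ^ 2) {i : Idx} (hi : i ∉ HH) :
    0 < onormSq i.1 / R + a - Real.sqrt 2 :=
  tailConst_pos hR hR3 (lt_of_not_ge fun h => hi ((hHH i).mpr h))

/-! ### §4 The index sets exist as `Finset`s -/

/-- `‖k‖_∞ ≤ |k|`: an orbit with `|O|² ≤ r²` lies in the cube `⌈|r|⌉`. -/
theorem osupNorm_le_of_onormSq_le {r : ℝ} {O : Orbit} (h : onormSq O ≤ r ^ 2) : osupNorm O ≤ ⌈|r|⌉₊ := by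
  rw [osupNorm, AbcClassII.supNorm]
  refine Finset.sup_le fun i _ => ?_
  have h1 : |(O.rep i : ℝ)| ≤ Real.sqrt (freqNormSq O.rep) := abs_apply_le_sqrt_freqNormSq O.rep i
  have h2 : Real.sqrt (freqNormSq O.rep) ≤ |r| := by
    rw [← Real.sqrt_sq_eq_abs]
    exact Real.sqrt_le_sqrt h
  have h3 : (((O.rep i).natAbs : ℕ) : ℝ) ≤ ⌈|r|⌉₊ := by
    have : (((O.rep i).natAbs : ℕ) : ℝ) = |(O.rep i : ℝ)| := by
      rw [Nat.cast_natAbs, Int.cast_abs]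
    rw [this]
    exact (h1.trans h2).trans (Nat.le_ceil _)
  exact_mod_cast h3

/-- **The ball index set exists**: `{i : |O_i|² ≤ r²}` is a `Finset`. -/
theorem exists_ballIdx (r : ℝ) : ∃ F : Finset Idx, ∀ i : Idx, i ∈ F ↔ onormSq i.1 ≤ r ^ 2 := by
  classical
  refine ⟨(cubeIdx ⌈|r|⌉₊).filter (fun i => onormSq i.1 ≤ r ^ 2), fun i => ?_⟩
  rw [Finset.mem_filter, mem_cubeIdx]
  exact ⟨fun h => h.2, fun h => ⟨osupNorm_le_of_onormSq_le h, h⟩⟩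

/-- **The shell index set exists**: `{i : r₁² < |O_i|² ≤ r₂²}` is a `Finset`. -/
theorem exists_shellIdx (r₁ r₂ : ℝ) :
    ∃ F : Finset Idx, ∀ i : Idx, i ∈ F ↔ r₁ ^ 2 < onormSq i.1 ∧ onormSq i.1 ≤ r₂ ^ 2 := by
  classical
  refine ⟨(cubeIdx ⌈|r₂|⌉₊).filter (fun i => r₁ ^ 2 < onormSq i.1 ∧ onormSq i.1 ≤ r₂ ^ 2), fun i => ?_⟩
  rw [Finset.mem_filter, mem_cubeIdx]
  exact ⟨fun h => h.2, fun h => ⟨osupNorm_le_of_onormSq_le h.2, h⟩⟩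

end Summit.NavierStokesRegularity.FluidComputer.AbcInertia

end
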